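import Summits.QuantumFields.YangMills.Theorems.FlatTubeReductionDecimationFrame
import Summits.QuantumFields.YangMills.Theorems.FlatTubeReductionDecimationSupport
import HarnessLib

/-!
# Route `FlatTubeReduction`, crux `PinnedUnitStepEx` (stmt-QuantumFields-27561), stub `stub_smearVarPosGS1` — D4a: membership in the fine support

Seat ym-line-fcl-p3 g9 (2026-08-28).  Blueprint file D4 (first part): which fine links belong to `fineSupp (L'+1) v R`, coordinate by coordinate,
at one doubled slab (`L = L'+1`).  A fine link `(y, i)` is a path link of the coarse link `(x', i)` iff `y = thinSite x' − v + s·e_i` with `s = 0`, or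
`s = 1` and `x'_i = 0`; its coordinates off `i` are `ι(x'_k) − v_k` (never the deleted value `1 − v_k`).  Lemmas: `mem_fineSupp_iff'`,
`pathLink_apply`, `thinCoord_add_step_inj` (the pair (coordinate, step) is determined by `ι a + s`), `out_mem_fineSupp_iff` / `mid_mem_fineSupp_iff` /
`in_mem_fineSupp_iff` (the three kinds of fine `j`-links at the image of a coarse site), `apply_ne_deleted_of_mem_fineSupp` (no support link touches a
deleted transverse coordinate).  The contractible-slice correspondence (C1) is the next file.  R2b1 RECORD rung; no summit/crux/stub here.
-/

set_option autoImplicit false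

namespace Summit.QuantumFields.YangMills.Theorems.FlatTubeReduction.Decimation

open Finset Function
open Literature.MathematicalPhysics.QuantumFieldTheory (Site Edge)
open Summit.QuantumFields.YangMills.Theorems.FemtoCutoffLadder.Thinning

variable {L' : ℕ} [NeZero L']

omit [NeZero L'] in
/-- Membership in the fine support, unfolded. [folklore] -/
theorem mem_fineSupp_iff' {v : Site 3 (L' + 1)} {R : Finset (Edge 3 L')} {f : Edge 3 (L' + 1)} :
    f ∈ fineSupp (L' + 1) v R ↔ ∃ x' : Site 3 L', ∃ s : ℕ, (x', f.2) ∈ R ∧ s < thinSteps (L' + 1) L' (x' f.2) ∧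
      f.1 = thinSite (L' + 1) x' + Pi.single f.2 ((s : ℕ) : ZMod (L' + 1)) - v := by
  constructor
  · intro hf
    obtain ⟨e', he', hfe⟩ := mem_fineSupp.1 hf
    obtain ⟨s, hs, rfl⟩ := mem_pathLinks.1 hfe
    exact ⟨e'.1, s, he', hs, rfl⟩
  · rintro ⟨x', s, hR, hs, hf⟩
    obtain ⟨y, i⟩ := f
    simp only at hR hs hf
    subst hf
    exact mem_fineSupp.2 ⟨(x', i), hR, mem_pathLinks.2 ⟨s, hs, rfl⟩⟩

omit [NeZero L'] in
/-- Coordinates of a path link base point. [folklore] -/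
theorem pathLink_apply (v : Site 3 (L' + 1)) (x' : Site 3 L') (i : Fin 3) (s : ℕ) (k : Fin 3) :
    (thinSite (L' + 1) x' + Pi.single i ((s : ℕ) : ZMod (L' + 1)) - v : Site 3 (L' + 1)) k =
      thinCoord (L' + 1) L' (x' k) - v k + (if k = i then ((s : ℕ) : ZMod (L' + 1)) else 0) := by
  simp only [Pi.sub_apply, Pi.add_apply, thinSite, Pi.single_apply]
  split_ifs <;> ring

omit [NeZero L'] in
/-- Admissible steps: `s < thinSteps a` means `s = 0`, or `s = 1` and `a = 0`. [folklore] -/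
theorem step_cases {a : ZMod L'} {s : ℕ} (hs : s < thinSteps (L' + 1) L' a) : s = 0 ∨ (s = 1 ∧ a = 0) := by
  rw [thinSteps_succ_eq] at hs
  split_ifs at hs with h
  · rcases Nat.lt_succ_iff.1 hs |>.eq_or_lt with h1 | h1
    · exact Or.inr ⟨h1, h⟩
    · exact Or.inl (by omega)
  · exact Or.inl (by omega)

/-- **The pair (coordinate, step) is determined by the fine coordinate `ι a + s`.** [folklore] -/
theorem thinCoord_add_step_inj {a b : ZMod L'} {s t : ℕ} (hs : s < thinSteps (L' + 1) L' a) (ht : t < thinSteps (L' + 1) L' b)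
    (h : thinCoord (L' + 1) L' a + ((s : ℕ) : ZMod (L' + 1)) = thinCoord (L' + 1) L' b + ((t : ℕ) : ZMod (L' + 1))) :
    a = b ∧ s = t := by
  have hinj := thinCoord_injective (L := L' + 1) (L' := L') (Nat.le_succ L')
  rcases step_cases hs with rfl | ⟨rfl, rfl⟩ <;> rcases step_cases ht with rfl | ⟨rfl, rfl⟩
  · simp only [Nat.cast_zero, add_zero] at h
    exact ⟨hinj h, rfl⟩
  · simp only [Nat.cast_zero, add_zero, Nat.cast_one] at h
    exact absurd h (thinCoord_add_one_not_mem_range (L := L' + 1) (Nat.le_succ L') (by rw [ZMod.val_zero]; omega) a)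
  · simp only [Nat.cast_zero, add_zero, Nat.cast_one] at h
    exact absurd h.symm (thinCoord_add_one_not_mem_range (L := L' + 1) (Nat.le_succ L') (by rw [ZMod.val_zero]; omega) b)
  · exact ⟨rfl, rfl⟩

/-- **No support link touches a deleted transverse coordinate**: if `(y, i) ∈ fineSupp v R` then `y_k ≠ 1 − v_k` for `k ≠ i`. [folklore] -/
theorem apply_ne_deleted_of_mem_fineSupp {v : Site 3 (L' + 1)} {R : Finset (Edge 3 L')} {y : Site 3 (L' + 1)} {i : Fin 3}
    (h : (y, i) ∈ fineSupp (L' + 1) v R) {k : Fin 3} (hk : k ≠ i) : y k ≠ 1 - v k := by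
  obtain ⟨x', s, -, -, hy⟩ := mem_fineSupp_iff'.1 h
  simp only at hy
  rw [hy, pathLink_apply, if_neg hk, add_zero]
  intro h1
  exact thinCoord_ne_one (x' k) (by have := congrArg (· + v k) h1; simpa using this)

omit [NeZero L'] in
/-- The `j`-coordinate of the base of a support link of direction `i ≠ j` is `ι(x'_j) − v_j` for its coarse link `(x', i)`. [folklore] -/
theorem exists_coarse_of_mem_fineSupp_transverse {v : Site 3 (L' + 1)} {R : Finset (Edge 3 L')} {y : Site 3 (L' + 1)} {i j : Fin 3}
    (h : (y, i) ∈ fineSupp (L' + 1) v R) (hij : j ≠ i) :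
    ∃ x' : Site 3 L', (x', i) ∈ R ∧ y j = thinCoord (L' + 1) L' (x' j) - v j := by
  obtain ⟨x', s, hR, -, hy⟩ := mem_fineSupp_iff'.1 h
  refine ⟨x', hR, ?_⟩
  simp only at hy
  rw [hy, pathLink_apply, if_neg hij, add_zero]

/-- **Outgoing link at the image of a coarse site**: `(thinSite x' − v, j) ∈ fineSupp v R ↔ (x', j) ∈ R`. [folklore] -/
theorem out_mem_fineSupp_iff (v : Site 3 (L' + 1)) (R : Finset (Edge 3 L')) (x' : Site 3 L') (j : Fin 3) :
    (thinSite (L' + 1) x' - v, j) ∈ fineSupp (L' + 1) v R ↔ (x', j) ∈ R := by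
  constructor
  · intro h
    obtain ⟨x'', s, hR, hs, hy⟩ := mem_fineSupp_iff'.1 h
    simp only at hR hs hy
    have hx : x'' = x' := by
      funext k
      have hk := congrFun (sub_left_injective hy) k
      simp only [Pi.add_apply, thinSite, Pi.single_apply] at hk
      by_cases hkj : k = j
      · subst hkj
        simp only [if_true] at hk
        have := thinCoord_add_step_inj (L' := L') (a := x' k) (b := x'' k) (s := 0) (t := s)
          (by rw [thinSteps_succ_eq]; split_ifs <;> omega) hs (by simpa using hk)
        exact this.1.symm
      · simp only [if_neg hkj, add_zero] at hk
        exact (thinCoord_injective (Nat.le_succ L') hk).symm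
    rw [← hx]; exact hR
  · intro h
    exact mem_fineSupp.2 ⟨(x', j), h, base_mem_pathLinks v (x', j)⟩

/-- **Middle link of a doubled path**: for `x'_j = 0`, `(thinSite x' + e_j − v, j) ∈ fineSupp v R ↔ (x', j) ∈ R`. [folklore] -/
theorem mid_mem_fineSupp_iff (v : Site 3 (L' + 1)) (R : Finset (Edge 3 L')) {x' : Site 3 L'} {j : Fin 3} (h0 : x' j = 0) :
    (thinSite (L' + 1) x' + Pi.single j 1 - v, j) ∈ fineSupp (L' + 1) v R ↔ (x', j) ∈ R := by
  have hstep : 1 < thinSteps (L' + 1) L' (x' j) := by rw [thinSteps_succ_eq, if_pos h0]; omega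
  constructor
  · intro h
    obtain ⟨x'', s, hR, hs, hy⟩ := mem_fineSupp_iff'.1 h
    simp only at hR hs hy
    have hx : x'' = x' := by
      funext k
      have hk := congrFun (sub_left_injective hy) k
      simp only [Pi.add_apply, thinSite, Pi.single_apply] at hk
      by_cases hkj : k = j
      · subst hkj
        simp only [if_true] at hk
        have := thinCoord_add_step_inj (L' := L') (a := x' k) (b := x'' k) (s := 1) (t := s) hstep hs
          (by simpa using hk)
        exact this.1.symm
      · simp only [if_neg hkj, add_zero] at hk
        exact (thinCoord_injective (Nat.le_succ L') hk).symm
    rw [← hx]; exact hR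
  · intro h
    have := mem_fineSupp (L := L' + 1) (v := v) (R := R)
      (f := (thinSite (L' + 1) x' + Pi.single j (((1 : ℕ) : ℕ) : ZMod (L' + 1)) - v, j)) |>.2
      ⟨(x', j), h, mem_pathLinks.2 ⟨1, hstep, rfl⟩⟩
    simpa using this

/-- **Incoming link at the image of a coarse site**: `(thinSite x' − v − e_j, j) ∈ fineSupp v R ↔ (x' − e_j, j) ∈ R` (the last link of the path
of the coarse link `(x' − e_j, j)`, doubled or not). [folklore] -/
theorem in_mem_fineSupp_iff (v : Site 3 (L' + 1)) (R : Finset (Edge 3 L')) (x' : Site 3 L') (j : Fin 3) :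
    (thinSite (L' + 1) x' - v - Pi.single j 1, j) ∈ fineSupp (L' + 1) v R ↔ (x' - Pi.single j 1, j) ∈ R := by
  -- the last link of the path of `b := x' − e_j`: offset `thinSteps(b_j) − 1`
  set b : Site 3 L' := x' - Pi.single j 1 with hb
  have hbj : b j + 1 = x' j := by simp [hb]
  have hlast : thinSite (L' + 1) x' - v - Pi.single j 1 =
      thinSite (L' + 1) b + Pi.single j (((thinSteps (L' + 1) L' (b j) - 1 : ℕ) : ℕ) : ZMod (L' + 1)) - v := by
    funext k
    simp only [Pi.sub_apply, Pi.add_apply, thinSite, Pi.single_apply]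
    by_cases hkj : k = j
    · subst hkj
      simp only [if_true]
      rw [← hbj, thinCoord_succ_add_one, thinSteps_succ_eq]
      split_ifs <;> push_cast <;> ring
    · simp only [if_neg hkj, sub_zero, add_zero]
      have : x' k = b k := by simp [hb, Pi.sub_apply, hkj]
      rw [this]
  rw [hlast]
  constructor
  · intro h
    obtain ⟨x'', s, hR, hs, hy⟩ := mem_fineSupp_iff'.1 h
    simp only at hR hs hy
    have hx : x'' = b := by
      funext k
      have hk := congrFun (sub_left_injective hy) k
      simp only [Pi.add_apply, thinSite, Pi.single_apply] at hk
      by_cases hkj : k = j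
      · subst hkj
        simp only [if_true] at hk
        have := thinCoord_add_step_inj (L' := L') (a := b k) (b := x'' k) (s := thinSteps (L' + 1) L' (b k) - 1) (t := s)
          (by have : 0 < thinSteps (L' + 1) L' (b k) := by rw [thinSteps_succ_eq]; split_ifs <;> omega
              omega) hs (by simpa using hk)
        exact this.1.symm
      · simp only [if_neg hkj, add_zero] at hk
        exact (thinCoord_injective (Nat.le_succ L') hk).symm
    rw [← hx]; exact hR
  · intro h
    refine mem_fineSupp.2 ⟨(b, j), h, mem_pathLinks.2 ⟨thinSteps (L' + 1) L' (b j) - 1, ?_, rfl⟩⟩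
    have : 0 < thinSteps (L' + 1) L' (b j) := by rw [thinSteps_succ_eq]; split_ifs <;> omega
    simp only
    omega

end Summit.QuantumFields.YangMills.Theorems.FlatTubeReduction.Decimation
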